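import Literature.Probability.RandomPlanarGeometry.SLEKappaRhoFlow
import Literature.Probability.RandomPlanarGeometry.SLEKappaRhoBesselEquation
import Literature.Probability.RandomPlanarGeometry.SLEKappaRhoDriving
import Literature.Analysis.FunctionSpaces.ItoProcessesProofs
import HarnessLib

/-!
# A regular version of the SLE(κ, ρ) driving process and its real flows as adapted processes

Infrastructure step of a proof of the named fact
`Literature.Probability.RandomPlanarGeometry.SLEKappaRho.ae_forall_ofReal_notMem_closure_hullUnion`
(`SLEKappaRhoFillVersion`), after

* G. F. Lawler, O. Schramm, W. Werner, *Conformal restriction: the chordal case*, J. Amer. Math.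
  Soc. **16** (2003) 917–955 (**[LSW]**), §8.3 (p. 36): SLE(κ, ρ) is driven by `W = Z + O`,
  `Z = √κ X` for a `d`-dimensional Bessel process `X`, `O_t = -2 ∫₀ᵗ du/Z_u`, and "note also that
  `∫₀ᵗ du/Z_u = (Z_t - √κ B_t)/(ρ + 2) < ∞`", i.e. `W_t = √κ B_t + ρ ∫₀ᵗ du/Z_u`;
* S. Rohde, O. Schramm, *Basic properties of SLE*, Ann. of Math. **161** (2005), proof of
  Lemma 7.2 (the real flows `X_t = g_t(x) - W_t`, `dX = (2/X) dt - dW`).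

The tree's SLE(κ, ρ) driving pair (`IsSLEKappaRhoPair κ ρ O W`, `SLEKappaRho`) is built from a
Bessel process whose paths are continuous only almost surely and whose time integral `O` is not
known to be adapted. For the stochastic calculus of the real Loewner flows of `W` we need an
INDISTINGUISHABLE version with better bookkeeping, which this file provides:

* `SLEKappaRho.RegularPair κ ρ W W' J` — a hypothesis bundle (not asserted): `W'` is adapted with
  `W'_0 = 0`, `J ≥ 0` is progressively measurable with `J = 1/(W' + 2 ∫₀ J)` pointwise (i.e.
  `J = 1/Z'` for `Z' = W' - O'`, `O' = -2 ∫₀ J`), and ALMOST SURELY: `W' = W` (all times), the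
  path of `W'` is continuous, `J` is integrable on every `[0, t]`, and
  `W'_t = √κ B_t + ρ ∫₀ᵗ J_s ds` for all `t`;
* `IsSLEKappaRhoPair.exists_regularPair` — **every SLE(κ, ρ) driving pair (`κ > 0`, `ρ > -2`)
  has a regular version**: `Z' = √κ √(dyadicReg Z)` for the progressive modification
  `dyadicReg Z` of the squared Bessel process of the construction
  (`IsStrongSolution.dyadicReg_spec`), `J = 1/Z'`, `W' = Z' - 2 ∫₀ J`; the almost-sure clauses are
  [LSW]'s displayed sentence (`SLEKappaRho.integral_inv_eq_holds`, `SLEKappaRho.ae_snd_eq_of`,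
  `IsSLEKappaRhoPair.ae_continuous`);
* the real flows `Loewner.flowProc W' x` (`SLEKappaRhoFlow`) of a regular version: adapted
  (`RegularPair.adapted_flowProc`), a.s. equal to the frozen real flows of `W`
  (`RegularPair.ae_flowProc_eq`), and — on the event that `x` is never swallowed — solving the
  integrated equation `X_t = x + ∫₀ᵗ (2/X_s - ρ J_s) ds - √κ B_t` for all `t`
  (`RegularPair.ae_flowProc_eq_integral`), the form consumed by the tree's Itô formula.

No named fact is introduced.
-/

noncomputable section

open Set Filter Topology MeasureTheory
open scoped NNReal
open Literature.Analysis.FunctionSpaces Literature.Probability.Process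

namespace Literature.Probability.RandomPlanarGeometry

/-! ### The bundle -/

/-- **A regular version `(W', J)` of the SLE(κ, ρ) driving process `W`** (time first, canonical
space): `W'` is adapted to the raw Brownian filtration with `W'_0 = 0`; `J ≥ 0` is progressively
measurable and is POINTWISE the inverse of `Z' := W' + 2 ∫₀ J` (so `Z' ≥ 0`, `O' := -2 ∫₀ J`,
`W' = Z' + O'` as in [LSW] §8.3); and almost surely: `W'_t = W_t` for all `t`, the path of `W'` is
continuous, `s ↦ J_s` is integrable on every `[0, t]`, and `W'_t = √κ B_t + ρ ∫₀ᵗ J_s ds` for all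
`t` ([LSW] §8.3: "`∫₀ᵗ du/Z_u = (Z_t - √κ B_t)/(ρ + 2) < ∞`"). A hypothesis bundle, supplied for
every SLE(κ, ρ) driving pair by `IsSLEKappaRhoPair.exists_regularPair`.
[cite: LawlerSchrammWerner2003Restriction, §8.3 (definition of SLE(κ, ρ), p. 36)] -/
structure SLEKappaRho.RegularPair (κ : ℝ≥0) (ρ : ℝ) (W W' J : ℝ≥0 → (ℝ≥0 → ℝ) → ℝ) : Prop where
  /-- `W'` is adapted to the raw Brownian filtration. -/
  adapted : Adapted brownianFiltration W'
  /-- `W'_0 = 0`. -/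
  apply_zero : ∀ ω, W' 0 ω = 0
  /-- `J` is progressively measurable. -/
  progressive : IsStronglyProgressive brownianFiltration J
  /-- `J ≥ 0`. -/
  nonneg : ∀ t ω, 0 ≤ J t ω
  /-- `J = 1/Z'` pointwise, `Z' = W' + 2 ∫₀ J`. -/
  eq_inv : ∀ t ω, J t ω = (W' t ω + 2 * timeIntegral J t ω)⁻¹
  /-- A.s. `W' = W` at all times. -/
  ae_eq : ∀ᵐ ω ∂preWienerMeasure, ∀ t, W' t ω = W t ω
  /-- A.s. the path of `W'` is continuous. -/
  ae_continuous : ∀ᵐ ω ∂preWienerMeasure, Continuous fun t ↦ W' t ω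
  /-- A.s. `J` is integrable on every `[0, t]`. -/
  ae_intervalIntegrable : ∀ᵐ ω ∂preWienerMeasure, ∀ t : ℝ≥0,
    IntervalIntegrable (fun s : ℝ ↦ J s.toNNReal ω) volume 0 t
  /-- A.s. `W'_t = √κ B_t + ρ ∫₀ᵗ J_s ds` for all `t`. -/
  ae_eq_brownian : ∀ᵐ ω ∂preWienerMeasure, ∀ t,
    W' t ω = Real.sqrt κ * brownian t ω + ρ * timeIntegral J t ω

/-! ### Existence of a regular version -/

/-- **Every SLE(κ, ρ) driving pair has a regular version** (`κ > 0`, `ρ > -2`): with the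
progressive modification `Z⁰ = dyadicReg Z` of the squared Bessel process `Z` of the construction
(`IsStrongSolution.dyadicReg_spec`: adapted, progressive, a.s. equal to `Z` at all times), set
`J = (√κ √Z⁰)⁻¹` and `W' = √κ √Z⁰ - 2 ∫₀ J`. On the a.s. event `Z⁰ = Z` these are the integrand
`1/Z_u` and the driving function `W = √κ X + O` of the pair themselves; the a.s. clauses are then
[LSW]'s "`∫₀ᵗ du/Z_u = (Z_t - √κ B_t)/(ρ + 2) < ∞`" (`SLEKappaRho.integral_inv_eq_holds`, whence
`W_t = √κ B_t + ρ ∫₀ᵗ du/Z_u`, `SLEKappaRho.ae_snd_eq_of`, and the continuity of the paths,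
`IsSLEKappaRhoPair.ae_continuous`).
[cite: LawlerSchrammWerner2003Restriction, §8.3 (definition of SLE(κ, ρ), p. 36)] -/
theorem IsSLEKappaRhoPair.exists_regularPair {κ : ℝ≥0} {ρ : ℝ} {O W : ℝ≥0 → (ℝ≥0 → ℝ) → ℝ}
    (hκ : 0 < κ) (hρ : -2 < ρ) (hOW : IsSLEKappaRhoPair κ ρ O W) :
    ∃ W' J, SLEKappaRho.RegularPair κ ρ W W' J := by
  obtain ⟨X, ⟨Z, hZ, hXZ⟩, hO, hW⟩ := id hOW
  obtain ⟨-, hprog, hae⟩ := IsStrongSolution.dyadicReg_spec hZ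
  set Zr := dyadicReg Z with hZr
  set J : ℝ≥0 → (ℝ≥0 → ℝ) → ℝ := fun s ω ↦ (Real.sqrt κ * Real.sqrt (Zr s ω))⁻¹ with hJ
  set W' : ℝ≥0 → (ℝ≥0 → ℝ) → ℝ :=
    fun t ω ↦ Real.sqrt κ * Real.sqrt (Zr t ω) + (-2) * timeIntegral J t ω with hW'
  have hJprog : IsStronglyProgressive brownianFiltration J := by
    have hF : Measurable (Function.uncurry fun (_ : ℝ) (v : ℝ) ↦ (Real.sqrt κ * Real.sqrt v)⁻¹) :=
      (measurable_const.mul measurable_snd.sqrt).inv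
    exact IsStronglyProgressive.comp_measurable₂ hprog (F := fun _ v ↦ (Real.sqrt κ * Real.sqrt v)⁻¹) hF
  have hZad : Adapted brownianFiltration Zr := adapted_dyadicReg hZ.adapted
  -- on the a.s. event `Zr = Z`: the integrand and the driving function are those of the pair
  have hJeq : ∀ ω, (∀ t, Zr t ω = Z t ω) → ∀ u : ℝ,
      J u.toNNReal ω = (W u.toNNReal ω - O u.toNNReal ω)⁻¹ := by
    intro ω hω u
    simp only [hJ, hω, hW u.toNNReal ω, hXZ u.toNNReal ω, add_sub_cancel_right]
  have hJeqX : ∀ ω, (∀ t, Zr t ω = Z t ω) → ∀ u : ℝ,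
      J u.toNNReal ω = (Real.sqrt κ * X u.toNNReal ω)⁻¹ := by
    intro ω hω u
    simp only [hJ, hω, hXZ u.toNNReal ω]
  have hW'eq : ∀ ω, (∀ t, Zr t ω = Z t ω) → ∀ t, W' t ω = W t ω := by
    intro ω hω t
    have hI : timeIntegral J t ω = ∫ u in (0 : ℝ)..(t : ℝ), (Real.sqrt κ * X u.toNNReal ω)⁻¹ := by
      simp only [timeIntegral]
      exact intervalIntegral.integral_congr fun u _ ↦ hJeqX ω hω u
    rw [hW t ω, hXZ t ω, hO t ω]
    simp only [hW', hω, hI]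
  refine ⟨W', J, ⟨?_, ?_, hJprog, ?_, ?_, ?_, ?_, ?_, ?_⟩⟩
  · -- adapted
    intro t
    exact (((hZad t).sqrt).const_mul _).add ((adapted_timeIntegral hJprog t).const_mul _)
  · -- `W'_0 = 0`
    intro ω
    have h0 : Zr 0 ω = 0 := by
      rw [hZr, dyadicReg_apply_zero, IsStrongSolution.apply_zero hZ]
      simp
    simp [hW', h0, timeIntegral_apply_zero]
  · -- `J ≥ 0`
    intro t ω
    exact inv_nonneg.2 (mul_nonneg (Real.sqrt_nonneg _) (Real.sqrt_nonneg _))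
  · -- `J = 1/Z'`
    intro t ω
    simp only [hW', hJ]
    ring_nf
  · -- a.s. `W' = W`
    filter_upwards [hae] with ω hω t using hW'eq ω hω t
  · -- a.s. continuity
    filter_upwards [hae, hOW.ae_continuous SLEKappaRho.integral_inv_eq_holds hκ hρ] with ω hω hc
    have : (fun t ↦ W' t ω) = fun t ↦ W t ω := funext (hW'eq ω hω)
    rw [this]
    exact hc.1
  · -- a.s. integrability of `J`
    filter_upwards [hae, SLEKappaRho.integral_inv_eq_holds hκ hρ hOW] with ω hω hint t
    have : (fun s : ℝ ↦ J s.toNNReal ω) = fun s ↦ (W s.toNNReal ω - O s.toNNReal ω)⁻¹ :=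
      funext (hJeq ω hω)
    rw [this]
    exact (hint t).1
  · -- a.s. `W' = √κ B + ρ ∫ J`
    filter_upwards [hae, SLEKappaRho.ae_snd_eq_of SLEKappaRho.integral_inv_eq_holds hκ hρ hOW]
      with ω hω hB t
    have hI : timeIntegral J t ω = ∫ u in (0 : ℝ)..(t : ℝ), (W u.toNNReal ω - O u.toNNReal ω)⁻¹ := by
      simp only [timeIntegral]
      exact intervalIntegral.integral_congr fun u _ ↦ hJeq ω hω u
    rw [hW'eq ω hω t, hI]
    exact hB t

/-! ### Consequences: the real flows of a regular version -/

namespace SLEKappaRho.RegularPair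

variable {κ : ℝ≥0} {ρ : ℝ} {W W' J : ℝ≥0 → (ℝ≥0 → ℝ) → ℝ}

/-- `Z' = W' + 2 ∫₀ J ≥ 0` (it is the inverse of `J ≥ 0`… rather, `J` is its inverse).
[cite: LawlerSchrammWerner2003Restriction, §8.3 (p. 36)] -/
theorem add_nonneg' (h : RegularPair κ ρ W W' J) (t : ℝ≥0) (ω : ℝ≥0 → ℝ) :
    0 ≤ W' t ω + 2 * timeIntegral J t ω := by
  have h1 := h.nonneg t ω
  rw [h.eq_inv t ω, inv_nonneg] at h1
  exact h1

/-- The paths of `W'` a.s. agree with those of `W` as functions. [folklore] -/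
theorem ae_path_eq (h : RegularPair κ ρ W W' J) :
    ∀ᵐ ω ∂preWienerMeasure, (fun t ↦ W' t ω) = fun t ↦ W t ω :=
  h.ae_eq.mono fun _ hω ↦ funext hω

/-- **The real flows of a regular version are adapted** (`x > 0`). [cite: Lawler2005, Ch. 4 §4.1] -/
theorem adapted_flowProc (h : RegularPair κ ρ W W' J) {x : ℝ} (hx : 0 < x) :
    Adapted brownianFiltration (Loewner.flowProc W' x) :=
  Loewner.adapted_flowProc h.adapted h.apply_zero hx

/-- **The real flows of a regular version are a.s. the frozen real flows of `W`**: a.s., for all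
`x` and `t`, `flowProc W' x t ω = realFlowStop (W · ω) x t`. [cite: Lawler2005, Ch. 4 §4.1] -/
theorem ae_flowProc_eq (h : RegularPair κ ρ W W' J) :
    ∀ᵐ ω ∂preWienerMeasure, ∀ (x : ℝ) (t : ℝ≥0),
      Loewner.flowProc W' x t ω = Loewner.realFlowStop (fun s ↦ W s ω) x t := by
  filter_upwards [h.ae_continuous, h.ae_path_eq] with ω hc heq x t
  rw [Loewner.flowProc_eq_of_continuous hc, heq]

/-- **The integrated Loewner equation of the real flows of a regular version.** Almost surely:
for every `x > 0` that is never swallowed by the chain of `W`, the flow process from `x` has a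
continuous positive path and, for all `t`,
`X_t = x + ∫₀ᵗ (2/X_s - ρ J_s) ds - √κ B_t`
with both `s ↦ 2/X_s` and `s ↦ J_s` integrable on `[0, t]` (Loewner's equation for real points,
`Loewner.realFlowStop_eq_sub_add_integral`, and `W'_t = √κ B_t + ρ ∫₀ᵗ J`). This is the SDE
`dX = (2/X) dt - dW_t`, `dW = ρ dt/Z + √κ dB` of [LSW] §8.3/§8.4 read on the real line
(Rohde–Schramm's `dX = (2/X) dt - √κ dB` for `ρ = 0`).
[cite: LawlerSchrammWerner2003Restriction, §8.3–8.4 (pp. 36–38)] -/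
theorem ae_flowProc_eq_integral (h : RegularPair κ ρ W W' J) :
    ∀ᵐ ω ∂preWienerMeasure, ∀ x : ℝ, 0 < x →
      Loewner.swallowingTime (fun s ↦ W s ω) x = ⊤ →
        (Continuous fun t ↦ Loewner.flowProc W' x t ω) ∧
        (∀ t, 0 < Loewner.flowProc W' x t ω) ∧
        (∀ t : ℝ≥0, IntervalIntegrable (fun s : ℝ ↦ 2 / Loewner.flowProc W' x s.toNNReal ω) volume 0 t) ∧
        (∀ t : ℝ≥0, IntervalIntegrable (fun s : ℝ ↦ J s.toNNReal ω) volume 0 t) ∧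
        ∀ t : ℝ≥0, Loewner.flowProc W' x t ω =
          x + (∫ s in (0 : ℝ)..t, (2 / Loewner.flowProc W' x s.toNNReal ω - ρ * J s.toNNReal ω)) -
            Real.sqrt κ * brownian t ω := by
  filter_upwards [h.ae_continuous, h.ae_path_eq, h.ae_intervalIntegrable, h.ae_eq_brownian]
    with ω hc heq hint hB x hx hT
  have heq' : ∀ t, W' t ω = W t ω := fun t ↦ congrFun heq t
  have hT' : Loewner.swallowingTime (fun s ↦ W' s ω) x = ⊤ := by rw [heq]; exact hT
  have hx0 : W' 0 ω < x := by rw [h.apply_zero]; exact hx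
  have hx0' : x ≠ W' 0 ω := hx0.ne'
  have hflow : ∀ t, Loewner.flowProc W' x t ω = Loewner.realFlowStop (fun s ↦ W' s ω) x t :=
    fun t ↦ Loewner.flowProc_eq_of_continuous hc x t
  have hlt : ∀ t : ℝ≥0, (t : WithTop ℝ≥0) < Loewner.swallowingTime (fun s ↦ W' s ω) x := fun t ↦ by
    rw [hT']; exact WithTop.coe_lt_top t
  have hcont : Continuous fun t ↦ Loewner.flowProc W' x t ω := Loewner.continuous_flowProc hc hx0
  have hpos : ∀ t, 0 < Loewner.flowProc W' x t ω := fun t ↦ by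
    rw [hflow t, Loewner.realFlowStop_of_lt (hlt t)]
    exact Loewner.realFlow_pos hc hx0 (hlt t)
  have hc2 : Continuous fun s : ℝ ↦ 2 / Loewner.flowProc W' x s.toNNReal ω :=
    continuous_const.div (hcont.comp continuous_real_toNNReal) fun s ↦ (hpos _).ne'
  have hint2 : ∀ t : ℝ≥0, IntervalIntegrable (fun s : ℝ ↦ 2 / Loewner.flowProc W' x s.toNNReal ω)
      volume 0 t := fun t ↦ hc2.intervalIntegrable _ _
  refine ⟨hcont, hpos, hint2, hint, fun t ↦ ?_⟩
  have h1 := Loewner.realFlowStop_eq_sub_add_integral hc hx0' (hlt t)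
  rw [intervalIntegral.integral_sub (hint2 t) ((hint t).const_mul ρ),
    intervalIntegral.integral_const_mul]
  simp only [hflow] at h1 ⊢
  rw [h1, hB t]
  simp only [timeIntegral]
  ring

end SLEKappaRho.RegularPair

end Literature.Probability.RandomPlanarGeometry

end
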